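import Summits.AtomisticToContinuum.HydrodynamicLimit.Theorems.CollisionIsometryCLTMacroClosureEngineDefs
import Summits.AtomisticToContinuum.HydrodynamicLimit.Theorems.CollisionIsometryCLTMacroClosureEngineEntropyLedgerA
import Summits.AtomisticToContinuum.HydrodynamicLimit.Theorems.CollisionIsometryCLTMacroClosureEngineInitial
import Summits.AtomisticToContinuum.HydrodynamicLimit.Theorems.CollisionIsometryCLTMacroClosureStubClausiusTotals
import Mathlib.MeasureTheory.Integral.Prod
import HarnessLib

/-!
# Sub-goal `engine_incrementBound` of the lead's `stub_engine_pointwise` (line `IdeatorTwoGen1Sketch`, crux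
# `MacroClosure`, stmt-AtomisticToContinuum-14870), part A: three glue lemmas

Helpers of the increment bound (file `…EngineIncrementBound.lean`):

* elementary moment bounds (`cube_le`, `moment_cube_le`: the cubic velocity moment is paid by the exponential one;
  `integral_normSq_eq`);
* `ell_bound`: the uniform bound `E[1_G |Y_τ|] ≤ B₀` on the linear statistic from the sup bounds of the entropy variables
  and the second moment of the energy per particle;
* `pathwise`: the PATHWISE increment bound on one good band trajectory — pure bookkeeping of the landed increment
  identity (`engine_incrementIdentity`) and production bound (`engine_productionBound`), both taken as hypotheses in
  instantiated form, with the good-event bounds of APS (i), FMR and CTL;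
* `engine_incrementBound_tonelli` (registered helper stub): Tonelli in `(τ, z)` for a non-negative jointly measurable
  good-event functional with bounded slices — `E[1_G ∫₀ˢ X_τ dτ] = ∫₀ˢ E[1_G X_τ] dτ` with all integrabilities.
-/

noncomputable section

open MeasureTheory Filter Set Topology InformationTheory
open scoped ENNReal ContDiff

namespace Summit.AtomisticToContinuum.HydrodynamicLimit.Theorems.MacroClosureLine

open Literature.MathematicalPhysics.KineticTheory Literature.Analysis.FluidPDE
open Literature.Analysis.FunctionSpaces

namespace Barycentric

namespace EngineIncrementBound


/-- `a³ ≤ 1 + 2λ⁻² e^{λa²}` for `a ≥ 0`, `λ > 0` (from `x²/2 ≤ eˣ`). [folklore] -/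
theorem cube_le {lam : ℝ} (hlam : 0 < lam) {a : ℝ} (ha : 0 ≤ a) :
    a ^ 3 ≤ 1 + 2 / lam ^ 2 * Real.exp (lam * a ^ 2) := by
  have h4 : a ^ 3 ≤ 1 + a ^ 4 := by
    rcases le_or_gt a 1 with h | h
    · have : a ^ 3 ≤ 1 := pow_le_one₀ ha h
      nlinarith [pow_nonneg ha 4]
    · have : a ^ 3 ≤ a ^ 4 := pow_le_pow_right₀ h.le (by norm_num)
      linarith
  have hx : 0 ≤ lam * a ^ 2 := by positivity
  have hexp : (lam * a ^ 2) ^ 2 / 2 ≤ Real.exp (lam * a ^ 2) := by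
    have h := Real.pow_div_factorial_le_exp (x := lam * a ^ 2) hx 2
    simpa [Nat.factorial] using h
  have hl2 : 0 < lam ^ 2 := by positivity
  have : a ^ 4 ≤ 2 / lam ^ 2 * Real.exp (lam * a ^ 2) := by
    rw [div_mul_eq_mul_div, le_div_iff₀ hl2]
    nlinarith
  linarith

/-- The cubic velocity moment of a configuration is paid by the exponential one:
`⟨emp w, 1 + |v|³⟩ ≤ 2 + 2λ⁻² ⟨emp w, e^{λ|v|²}⟩`. [folklore] -/
theorem moment_cube_le {lam : ℝ} (hlam : 0 < lam) {n : ℕ} (w : Config (n + 1) (Fin 3) T3) :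
    ∫ y, (1 + ‖y.2‖ ^ 3) ∂(empiricalMeasure w) ≤
      2 + 2 / lam ^ 2 * ∫ y, Real.exp (lam * ‖y.2‖ ^ 2) ∂(empiricalMeasure w) := by
  rw [integral_empiricalMeasure, integral_empiricalMeasure]
  have hN : (0 : ℝ) < (n + 1 : ℕ) := by positivity
  have hsum : ∑ i, (1 + ‖(w i).2‖ ^ 3) ≤ ∑ i, (2 + 2 / lam ^ 2 * Real.exp (lam * ‖(w i).2‖ ^ 2)) :=
    Finset.sum_le_sum fun i _ => by linarith [cube_le hlam (norm_nonneg (w i).2)]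
  calc ((n + 1 : ℕ) : ℝ)⁻¹ * ∑ i, (1 + ‖(w i).2‖ ^ 3)
      ≤ ((n + 1 : ℕ) : ℝ)⁻¹ * ∑ i, (2 + 2 / lam ^ 2 * Real.exp (lam * ‖(w i).2‖ ^ 2)) :=
        mul_le_mul_of_nonneg_left hsum (inv_nonneg.2 hN.le)
    _ = 2 + 2 / lam ^ 2 * (((n + 1 : ℕ) : ℝ)⁻¹ * ∑ i, Real.exp (lam * ‖(w i).2‖ ^ 2)) := by
        rw [Finset.sum_add_distrib, Finset.sum_const, Finset.card_univ, Fintype.card_fin, ← Finset.mul_sum]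
        field_simp
        push_cast
        ring

/-- `∫ ‖v‖² d(emp w) = 2 e(w)` with `e` the energy per particle. [folklore] -/
theorem integral_normSq_eq {n : ℕ} (w : Config (n + 1) (Fin 3) T3) :
    ∫ y, ‖y.2‖ ^ 2 ∂(empiricalMeasure w) = 2 * empiricalEnergyField w fun _ => (1 : ℝ) := by
  rw [integral_empiricalMeasure, Clausius.empiricalEnergyField_one]
  have h : ∑ i, ‖(w i).2‖ ^ 2 / 2 = (∑ i, ‖(w i).2‖ ^ 2) / 2 := by rw [Finset.sum_div]
  rw [h]
  ring

/-- **Uniform bound on the linear statistic**: with sup bounds `A0, AM, AE` of the entropy variables at time `τ`,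
`AΛ, AU` of `Λ_cl(τ,·)`, `U_cl(τ,·)`, and `∫ e dP ≤ M₀ + 1` for the (conserved) energy per particle,
`|E[1_G (Obs(τ, Φ_τ z) − ∫ₓ Λ_cl(τ)·U_cl(τ))]| ≤ (A0 + 3AM/2 + AΛ AU) + (3AM + AE)(M₀ + 1)`. [folklore] -/
theorem ell_bound {N : ℕ} (P : Measure (Config (N + 1) (Fin 3) T3)) [IsProbabilityMeasure P] {σ : ℝ}
    {ρ θ : ℝ → T3 → ℝ} {u : ℝ → T3 → V3} (Φ : Flow σ N) {G : Set (Config (N + 1) (Fin 3) T3)}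
    (hGgood : G ⊆ Φ.good) {τ A0 AM AE AΛ AU M₀ : ℝ}
    (hA0 : ∀ x, |lam0 σ ρ θ u τ x| ≤ A0) (hAM : ∀ x j, |lamM θ u τ x j| ≤ AM) (hAE : ∀ x, |lamE θ τ x| ≤ AE)
    (hAΛ : ∀ x, ‖Lcl σ ρ θ u τ x‖ ≤ AΛ) (hAU : ∀ x, ‖Ucl ρ θ u τ x‖ ≤ AU)
    (he_int : Integrable (fun z => empiricalEnergyField z fun _ => (1 : ℝ)) P)
    (he_le : ∫ z, empiricalEnergyField z (fun _ => (1 : ℝ)) ∂P ≤ M₀ + 1)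
    (hint : Integrable (G.indicator
      (fun z => obs σ ρ θ u τ (Φ.flow τ z) - ∫ x, Lcl σ ρ θ u τ x (Ucl ρ θ u τ x))) P) :
    |∫ z, G.indicator (fun z => obs σ ρ θ u τ (Φ.flow τ z) - ∫ x, Lcl σ ρ θ u τ x (Ucl ρ θ u τ x)) z ∂P| ≤
      (A0 + 3 * AM / 2 + AΛ * AU) + (3 * AM + AE) * (M₀ + 1) := by
  haveI hT3 : IsProbabilityMeasure (volume : Measure T3) := inferInstance
  have hA0pos : 0 ≤ A0 := (abs_nonneg _).trans (hA0 0)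
  have hAMpos : 0 ≤ AM := (abs_nonneg _).trans (hAM 0 0)
  have hAEpos : 0 ≤ AE := (abs_nonneg _).trans (hAE 0)
  have hAΛpos : 0 ≤ AΛ := (norm_nonneg _).trans (hAΛ 0)
  have hAUpos : 0 ≤ AU := (norm_nonneg _).trans (hAU 0)
  have he0 : ∀ z : Config (N + 1) (Fin 3) T3, 0 ≤ empiricalEnergyField z fun _ => (1 : ℝ) := fun z =>
    Clausius.empiricalEnergyField_one_nonneg z
  have hpair : |∫ x, Lcl σ ρ θ u τ x (Ucl ρ θ u τ x)| ≤ AΛ * AU := by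
    have h1 : ‖∫ x, Lcl σ ρ θ u τ x (Ucl ρ θ u τ x)‖ ≤ AΛ * AU * (volume : Measure T3).real univ := by
      refine norm_integral_le_of_norm_le_const (Filter.Eventually.of_forall fun x => ?_)
      calc ‖Lcl σ ρ θ u τ x (Ucl ρ θ u τ x)‖ ≤ ‖Lcl σ ρ θ u τ x‖ * ‖Ucl ρ θ u τ x‖ :=
            ContinuousLinearMap.le_opNorm _ _
        _ ≤ AΛ * AU := mul_le_mul (hAΛ x) (hAU x) (norm_nonneg _) hAΛpos
    rw [Real.norm_eq_abs, probReal_univ, mul_one] at h1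
    exact h1
  have hYbound : ∀ z ∈ Φ.good,
      |obs σ ρ θ u τ (Φ.flow τ z) - ∫ x, Lcl σ ρ θ u τ x (Ucl ρ θ u τ x)| ≤
        (A0 + 3 * AM / 2 + AΛ * AU) + (3 * AM + AE) * empiricalEnergyField z fun _ => (1 : ℝ) := by
    intro z hz
    have hobs := EngineInitial.abs_obs_le hA0 hAM hAE (Φ.flow τ z)
    have hen : (empiricalEnergyField (Φ.flow τ z) fun _ => (1 : ℝ)) = empiricalEnergyField z fun _ => (1 : ℝ) :=
      (Clausius.totals_flow Φ hz τ).2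
    have hsplit := abs_sub (obs σ ρ θ u τ (Φ.flow τ z)) (∫ x, Lcl σ ρ θ u τ x (Ucl ρ θ u τ x))
    rw [hen] at hobs
    linarith
  calc |∫ z, G.indicator (fun z => obs σ ρ θ u τ (Φ.flow τ z) - ∫ x, Lcl σ ρ θ u τ x (Ucl ρ θ u τ x)) z ∂P|
      ≤ ∫ z, |G.indicator (fun z => obs σ ρ θ u τ (Φ.flow τ z) - ∫ x, Lcl σ ρ θ u τ x (Ucl ρ θ u τ x)) z| ∂P :=
        abs_integral_le_integral_abs
    _ ≤ ∫ z, ((A0 + 3 * AM / 2 + AΛ * AU) + (3 * AM + AE) * empiricalEnergyField z fun _ => (1 : ℝ)) ∂P := by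
        refine integral_mono hint.abs ((integrable_const _).add (he_int.const_mul _)) fun z => ?_
        by_cases hz : z ∈ G
        · simp only [indicator_of_mem hz]
          exact hYbound z (hGgood hz)
        · simp only [indicator_of_notMem hz, abs_zero]
          have h1 : 0 ≤ A0 + 3 * AM / 2 + AΛ * AU := by positivity
          nlinarith [he0 z]
    _ = (A0 + 3 * AM / 2 + AΛ * AU) + (3 * AM + AE) * ∫ z, empiricalEnergyField z (fun _ => (1 : ℝ)) ∂P := by
        rw [integral_add (integrable_const _) (he_int.const_mul _), integral_const, integral_const_mul]
        simp
    _ ≤ (A0 + 3 * AM / 2 + AΛ * AU) + (3 * AM + AE) * (M₀ + 1) := by nlinarith [he_le]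

/-- **The pathwise increment bound on one good band trajectory** (bookkeeping). From the increment identity
(`engine_incrementIdentity`, hypothesis `hid`), the production bound (`engine_productionBound`, hypothesis `hS1`,
integrated over `[0,s]`), the good-event bounds `∫₀ᵗ⟨e^{λ|v|²}⟩ ≤ Cexp`, `∫₀ᵗ defect ≤ δ`, `|ccRes − ∫∫cc| ≤ δ`, and
`|v|³ ≤ 1 + 2λ⁻² e^{λ|v|²}`:
`Y(0) − Y(s) ≤ K₁√M ∫₀ˢ X + (K√M e^{−λM/4} + δ + C_b r (2t + 2λ⁻²|Cexp|)) + C_b √(δ t) (1 + e(z))`,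
`K = K₁ max(1, Cexp)`. [folklore] -/
theorem pathwise {N : ℕ} {σ T : ℝ} {ρ θ : ℝ → T3 → ℝ} {u : ℝ → T3 → V3} (Φ : Flow σ N) (φ : T3 → ℝ)
    {z : Config (N + 1) (Fin 3) T3} {s t lam Cexp δ r K₁ K Cb M : ℝ} (hs : s ∈ Icc 0 t)
    (ht : 0 < t) (hlam : 0 < lam) (hδ : 0 ≤ δ) (hr : 0 ≤ r) (hK₁ : 0 ≤ K₁) (hCb : 0 ≤ Cb)
    (hKdef : K = K₁ * max 1 Cexp)
    (iPB : IntegrableOn (fun τ => prodBlock σ T ρ θ u φ τ (Φ.flow τ z)) (Icc 0 t))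
    (iPC : IntegrableOn (fun τ => prodCl σ T ρ θ u τ) (Icc 0 t))
    (iX : IntegrableOn (fun τ => ∫ x, relEnt σ (bU φ (Φ.flow τ z) x) (Ucl ρ θ u τ x)) (Icc 0 t))
    (iA : IntegrableOn (fun τ => ∫ y, Real.exp (lam * ‖y.2‖ ^ 2) ∂(empiricalMeasure (Φ.flow τ z))) (Icc 0 t))
    (i3 : IntegrableOn (fun τ => ∫ y, (1 + ‖y.2‖ ^ 3) ∂(empiricalMeasure (Φ.flow τ z))) (Icc 0 t))
    (hS1 : ∀ τ ∈ Icc 0 t, prodCl σ T ρ θ u τ - prodBlock σ T ρ θ u φ τ (Φ.flow τ z) ≤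
      K₁ * Real.sqrt M * (∫ x, relEnt σ (bU φ (Φ.flow τ z) x) (Ucl ρ θ u τ x)) +
        K₁ * Real.sqrt M * Real.exp (-(lam * M / 4)) * ∫ y, Real.exp (lam * ‖y.2‖ ^ 2) ∂(empiricalMeasure (Φ.flow τ z)))
    (hid : |(obs σ ρ θ u s (Φ.flow s z) - ∫ x, Lcl σ ρ θ u s x (Ucl ρ θ u s x)) -
        (obs σ ρ θ u 0 z - ∫ x, Lcl σ ρ θ u 0 x (Ucl ρ θ u 0 x)) -
        ∫ τ in Icc 0 s, (prodBlock σ T ρ θ u φ τ (Φ.flow τ z) - prodCl σ T ρ θ u τ)| ≤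
      |ccRes θ u Φ z s - ∫ τ in Icc 0 s, ∫ x, ccClosure σ θ u φ τ (Φ.flow τ z) x| +
        Cb * r * (∫ τ in Icc 0 t, ∫ y, (1 + ‖y.2‖ ^ 3) ∂(empiricalMeasure (Φ.flow τ z))) +
        Cb * Real.sqrt (∫ τ in Icc 0 t, ∫ x, ((∑ j, ∑ k, bD φ (Φ.flow τ z) x j k ^ 2) + ‖bq φ (Φ.flow τ z) x‖ ^ 2)) *
          Real.sqrt (t * (1 + ∫ y, ‖y.2‖ ^ 2 ∂(empiricalMeasure z))))
    (hCexp : ∫ τ in Icc 0 t, ∫ y, Real.exp (lam * ‖y.2‖ ^ 2) ∂(empiricalMeasure (Φ.flow τ z)) ≤ Cexp)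
    (hdef : ∫ τ in Icc 0 t, ∫ x, ((∑ j, ∑ k, bD φ (Φ.flow τ z) x j k ^ 2) + ‖bq φ (Φ.flow τ z) x‖ ^ 2) ≤ δ)
    (hcc : |ccRes θ u Φ z s - ∫ τ in Icc 0 s, ∫ x, ccClosure σ θ u φ τ (Φ.flow τ z) x| ≤ δ) :
    (obs σ ρ θ u 0 z - ∫ x, Lcl σ ρ θ u 0 x (Ucl ρ θ u 0 x)) -
        (obs σ ρ θ u s (Φ.flow s z) - ∫ x, Lcl σ ρ θ u s x (Ucl ρ θ u s x)) ≤
      K₁ * Real.sqrt M * (∫ τ in Icc 0 s, ∫ x, relEnt σ (bU φ (Φ.flow τ z) x) (Ucl ρ θ u τ x)) +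
        (K * Real.sqrt M * Real.exp (-(lam * M / 4)) + δ + Cb * r * (2 * t + 2 / lam ^ 2 * |Cexp|)) +
        Cb * Real.sqrt (δ * t) * (1 + empiricalEnergyField z fun _ => (1 : ℝ)) := by
  set X : ℝ → ℝ := fun τ => ∫ x, relEnt σ (bU φ (Φ.flow τ z) x) (Ucl ρ θ u τ x) with hX
  set A : ℝ → ℝ := fun τ => ∫ y, Real.exp (lam * ‖y.2‖ ^ 2) ∂(empiricalMeasure (Φ.flow τ z)) with hA
  set e : ℝ := empiricalEnergyField z fun _ => (1 : ℝ) with he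
  have he0 : 0 ≤ e := Clausius.empiricalEnergyField_one_nonneg z
  have hsub : Icc (0 : ℝ) s ⊆ Icc 0 t := Icc_subset_Icc le_rfl hs.2
  have hexp0 : 0 ≤ Real.exp (-(lam * M / 4)) := (Real.exp_pos _).le
  -- (S1) integrated over `[0, s]`
  have hprodInt : ∫ τ in Icc 0 s, (prodCl σ T ρ θ u τ - prodBlock σ T ρ θ u φ τ (Φ.flow τ z)) ≤
      ∫ τ in Icc 0 s, (K₁ * Real.sqrt M * X τ + K₁ * Real.sqrt M * Real.exp (-(lam * M / 4)) * A τ) :=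
    setIntegral_mono_on (IntegrableOn.mono_set (iPC.sub iPB) hsub)
      (IntegrableOn.mono_set ((iX.const_mul _).add (iA.const_mul _)) hsub) measurableSet_Icc
      fun τ hτ => hS1 τ (hsub hτ)
  have hsplitR : ∫ τ in Icc 0 s, (K₁ * Real.sqrt M * X τ + K₁ * Real.sqrt M * Real.exp (-(lam * M / 4)) * A τ) =
      K₁ * Real.sqrt M * (∫ τ in Icc 0 s, X τ) +
        K₁ * Real.sqrt M * Real.exp (-(lam * M / 4)) * ∫ τ in Icc 0 s, A τ := by
    rw [integral_add (IntegrableOn.mono_set (iX.const_mul _) hsub)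
      (IntegrableOn.mono_set (iA.const_mul _) hsub), integral_const_mul, integral_const_mul]
  have hA0' : ∀ τ, 0 ≤ A τ := fun τ => integral_nonneg fun y => (Real.exp_pos _).le
  have hAle : ∫ τ in Icc 0 s, A τ ≤ Cexp :=
    (setIntegral_mono_set iA (Filter.Eventually.of_forall hA0') (Filter.Eventually.of_forall hsub)).trans hCexp
  have hflip : ∫ τ in Icc 0 s, (prodBlock σ T ρ θ u φ τ (Φ.flow τ z) - prodCl σ T ρ θ u τ) =
      -∫ τ in Icc 0 s, (prodCl σ T ρ θ u τ - prodBlock σ T ρ θ u φ τ (Φ.flow τ z)) := by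
    rw [← integral_neg]
    refine integral_congr_ae (Filter.Eventually.of_forall fun τ => ?_)
    ring
  -- the error terms
  have h3le : ∫ τ in Icc 0 t, ∫ y, (1 + ‖y.2‖ ^ 3) ∂(empiricalMeasure (Φ.flow τ z)) ≤ 2 * t + 2 / lam ^ 2 * |Cexp| := by
    have h1 : ∫ τ in Icc 0 t, ∫ y, (1 + ‖y.2‖ ^ 3) ∂(empiricalMeasure (Φ.flow τ z)) ≤
        ∫ τ in Icc 0 t, (2 + 2 / lam ^ 2 * A τ) :=
      setIntegral_mono_on i3 ((integrable_const (2 : ℝ)).add (iA.const_mul _)) measurableSet_Icc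
        fun τ _ => moment_cube_le hlam _
    have h2 : ∫ τ in Icc 0 t, (2 + 2 / lam ^ 2 * A τ) = 2 * t + 2 / lam ^ 2 * ∫ τ in Icc 0 t, A τ := by
      rw [integral_add (integrable_const (2 : ℝ)) (iA.const_mul _), integral_const_mul,
        setIntegral_const, Real.volume_real_Icc_of_le ht.le, sub_zero, smul_eq_mul, mul_comm]
    have h3 : 2 / lam ^ 2 * ∫ τ in Icc 0 t, A τ ≤ 2 / lam ^ 2 * |Cexp| :=
      mul_le_mul_of_nonneg_left (hCexp.trans (le_abs_self _)) (by positivity)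
    linarith
  have hdefle : Real.sqrt (∫ τ in Icc 0 t, ∫ x, ((∑ j, ∑ k, bD φ (Φ.flow τ z) x j k ^ 2) +
      ‖bq φ (Φ.flow τ z) x‖ ^ 2)) ≤ Real.sqrt δ := Real.sqrt_le_sqrt hdef
  have henergy : Real.sqrt (t * (1 + ∫ y, ‖y.2‖ ^ 2 ∂(empiricalMeasure z))) ≤ Real.sqrt t * (1 + e) := by
    rw [integral_normSq_eq, Real.sqrt_mul ht.le]
    refine mul_le_mul_of_nonneg_left ?_ (Real.sqrt_nonneg _)
    rw [Real.sqrt_le_left (by linarith)]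
    nlinarith
  have hsqt0 : 0 ≤ Real.sqrt (t * (1 + ∫ y, ‖y.2‖ ^ 2 ∂(empiricalMeasure z))) := Real.sqrt_nonneg _
  have hprod2 : Cb * Real.sqrt (∫ τ in Icc 0 t, ∫ x, ((∑ j, ∑ k, bD φ (Φ.flow τ z) x j k ^ 2) +
        ‖bq φ (Φ.flow τ z) x‖ ^ 2)) * Real.sqrt (t * (1 + ∫ y, ‖y.2‖ ^ 2 ∂(empiricalMeasure z))) ≤
      Cb * Real.sqrt (δ * t) * (1 + e) := by
    calc Cb * Real.sqrt (∫ τ in Icc 0 t, ∫ x, ((∑ j, ∑ k, bD φ (Φ.flow τ z) x j k ^ 2) +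
          ‖bq φ (Φ.flow τ z) x‖ ^ 2)) * Real.sqrt (t * (1 + ∫ y, ‖y.2‖ ^ 2 ∂(empiricalMeasure z)))
        ≤ Cb * Real.sqrt δ * (Real.sqrt t * (1 + e)) := by
          apply mul_le_mul (mul_le_mul_of_nonneg_left hdefle hCb) henergy hsqt0
          exact mul_nonneg hCb (Real.sqrt_nonneg _)
      _ = Cb * Real.sqrt (δ * t) * (1 + e) := by rw [Real.sqrt_mul hδ]; ring
  have hr3 : Cb * r * ∫ τ in Icc 0 t, ∫ y, (1 + ‖y.2‖ ^ 3) ∂(empiricalMeasure (Φ.flow τ z)) ≤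
      Cb * r * (2 * t + 2 / lam ^ 2 * |Cexp|) := mul_le_mul_of_nonneg_left h3le (mul_nonneg hCb hr)
  have hKK : K₁ * Real.sqrt M * Real.exp (-(lam * M / 4)) * ∫ τ in Icc 0 s, A τ ≤
      K * Real.sqrt M * Real.exp (-(lam * M / 4)) := by
    rw [hKdef]
    have h1 : ∫ τ in Icc 0 s, A τ ≤ max 1 Cexp := hAle.trans (le_max_right _ _)
    have h2 : 0 ≤ K₁ * Real.sqrt M * Real.exp (-(lam * M / 4)) := by positivity
    calc K₁ * Real.sqrt M * Real.exp (-(lam * M / 4)) * ∫ τ in Icc 0 s, A τ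
        ≤ K₁ * Real.sqrt M * Real.exp (-(lam * M / 4)) * max 1 Cexp := mul_le_mul_of_nonneg_left h1 h2
      _ = K₁ * max 1 Cexp * Real.sqrt M * Real.exp (-(lam * M / 4)) := by ring
  have habs := abs_le.1 hid
  rw [hflip] at habs
  linarith [habs.1, habs.2, hprodInt, hsplitR, hKK, hr3, hprod2, hcc]

end EngineIncrementBound

/-- **Tonelli for a non-negative good-event functional with bounded slices** (registered helper stub
`engine_incrementBound_tonelli` of `engine_incrementBound`): if `(τ, z) ↦ 1_G(z) X(τ, z)` is a.e.-strongly
measurable on `[0,s] × Ω`, non-negative, with integrable `z`-slices of integral `≤ B` for every `τ ≤ s`, then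
`τ ↦ E[1_G X_τ]` is integrable on `[0,s]`, `z ↦ 1_G(z) ∫₀ˢ X(τ,z) dτ` is integrable, and
`E[1_G ∫₀ˢ X_τ dτ] = ∫₀ˢ E[1_G X_τ] dτ`. [folklore] -/
theorem engine_incrementBound_tonelli : ∀ {N : ℕ} (P : Measure (Config (N + 1) (Fin 3) T3)) [IsFiniteMeasure P]
    (G : Set (Config (N + 1) (Fin 3) T3)) (X : ℝ → Config (N + 1) (Fin 3) T3 → ℝ) (s B : ℝ),
    AEStronglyMeasurable (fun p : ℝ × Config (N + 1) (Fin 3) T3 => G.indicator (X p.1) p.2)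
      ((volume.restrict (Icc 0 s)).prod P) →
    (∀ τ ∈ Icc 0 s, ∀ z, 0 ≤ G.indicator (X τ) z) →
    (∀ τ ∈ Icc 0 s, Integrable (G.indicator (X τ)) P) →
    (∀ τ ∈ Icc 0 s, ∫ z, G.indicator (X τ) z ∂P ≤ B) →
    IntegrableOn (fun τ => ∫ z, G.indicator (X τ) z ∂P) (Icc 0 s) ∧
    Integrable (fun z => G.indicator (fun z => ∫ τ in Icc 0 s, X τ z) z) P ∧
    ∫ z, G.indicator (fun z => ∫ τ in Icc 0 s, X τ z) z ∂P = ∫ τ in Icc 0 s, ∫ z, G.indicator (X τ) z ∂P := by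
  intro N P _ G X s B hmeas h0 hslice hle
  set F : ℝ × Config (N + 1) (Fin 3) T3 → ℝ := fun p => G.indicator (X p.1) p.2 with hF
  set Hf : ℝ → ℝ := fun τ => ∫ z, G.indicator (X τ) z ∂P with hHf
  have hmeas' : AEStronglyMeasurable F ((volume.restrict (Icc 0 s)).prod P) := hmeas
  have hF0 : ∀ p : ℝ × Config (N + 1) (Fin 3) T3, p.1 ∈ Icc 0 s → 0 ≤ F p := fun p hp => h0 p.1 hp p.2
  have hH0 : ∀ τ ∈ Icc 0 s, 0 ≤ Hf τ := fun τ hτ => integral_nonneg (h0 τ hτ)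
  have hnorm : ∀ τ ∈ Icc 0 s, (∫ z, ‖F (τ, z)‖ ∂P) = Hf τ := by
    intro τ hτ
    refine integral_congr_ae (Filter.Eventually.of_forall fun z => ?_)
    simp only [Real.norm_eq_abs]
    exact abs_of_nonneg (hF0 (τ, z) hτ)
  have hHmeas : AEStronglyMeasurable Hf (volume.restrict (Icc 0 s)) := by
    refine hmeas'.integral_prod_right'.congr ?_
    exact (ae_restrict_iff' measurableSet_Icc).2 (Filter.Eventually.of_forall fun τ _ => rfl)
  have hHint : IntegrableOn Hf (Icc 0 s) := by
    refine ⟨hHmeas, HasFiniteIntegral.of_bounded (C := B) ?_⟩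
    refine (ae_restrict_iff' measurableSet_Icc).2 (Filter.Eventually.of_forall fun τ hτ => ?_)
    rw [Real.norm_eq_abs, abs_of_nonneg (hH0 τ hτ)]
    exact hle τ hτ
  have hprod : Integrable F ((volume.restrict (Icc 0 s)).prod P) := by
    rw [integrable_prod_iff hmeas']
    refine ⟨(ae_restrict_iff' measurableSet_Icc).2 (Filter.Eventually.of_forall fun τ hτ => hslice τ hτ), ?_⟩
    exact hHint.congr_fun (fun τ hτ => (hnorm τ hτ).symm) measurableSet_Icc
  have hswap := integral_integral_swap (f := fun τ z => F (τ, z)) hprod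
  have hmarg : ∀ z, (∫ τ in Icc 0 s, F (τ, z)) = G.indicator (fun z => ∫ τ in Icc 0 s, X τ z) z := by
    intro z
    by_cases hz : z ∈ G
    · simp only [hF, indicator_of_mem hz]
    · simp only [hF, indicator_of_notMem hz, integral_zero]
  have hint_z : Integrable (fun z => ∫ τ in Icc 0 s, F (τ, z)) P := hprod.integral_prod_right
  refine ⟨hHint, hint_z.congr (Filter.Eventually.of_forall hmarg), ?_⟩
  calc ∫ z, G.indicator (fun z => ∫ τ in Icc 0 s, X τ z) z ∂P
      = ∫ z, (∫ τ in Icc 0 s, F (τ, z)) ∂P := integral_congr_ae (Filter.Eventually.of_forall fun z => (hmarg z).symm)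
    _ = ∫ τ in Icc 0 s, ∫ z, F (τ, z) ∂P := hswap.symm
    _ = ∫ τ in Icc 0 s, Hf τ := setIntegral_congr_fun measurableSet_Icc fun τ _ => rfl

end Barycentric

end Summit.AtomisticToContinuum.HydrodynamicLimit.Theorems.MacroClosureLine

end
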